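import Mathlib.RingTheory.Etale.Kaehler
import Mathlib.RingTheory.Derivation.Basic
import Mathlib.FieldTheory.IntermediateField.Adjoin.Basic
import Mathlib.FieldTheory.Separable
import Mathlib.FieldTheory.Minpoly.Field
import Mathlib.FieldTheory.Perfect
import HarnessLib

/-!
# Derivations of fields: extension to fraction fields, algebraic elements, generators

Trunk T-TRANSCEND (`Literature/NumberTheory/Transcendental`). Commutative-algebra tools used in
the tree's proof of Ax's theorem (J. Ax, *On Schanuel's conjectures*, Ann. of Math. 93 (1971),
Thm. 3) and of Kirby's weak Schanuel property (J. Kirby, Bull. Lond. Math. Soc. 42 (2010),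
Thm. 1.2), all folklore (see e.g. S. Lang, *Algebra*, Ch. VIII §5, "Derivations"):

* `Literature.NumberTheory.Transcendental.exists_derivation_extend_of_isFractionRing`: a derivation `A → K` into the fraction field
  `K` of `A` extends to a derivation `K → K` (proved through Kähler differentials:
  `Ω[K⁄R]` is the localisation of `Ω[A⁄R]`, Mathlib's `KaehlerDifferential.isLocalizedModule_map`).
* `Literature.NumberTheory.Transcendental.derivation_eq_of_isFractionRing`: two derivations of `K` agreeing on `A` agree.
* `Literature.NumberTheory.Transcendental.derivation_eq_zero_of_isAlgebraic`: in characteristic `0`, a derivation of a field `L`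
  vanishing on a subfield `F` vanishes at every element algebraic over `F`
  (`0 = D(p(a)) = p'(a) · D a` with `p` the (separable) minimal polynomial).
* `Literature.NumberTheory.Transcendental.derivation_eq_zero_on_adjoin`: a derivation vanishing on `F` and on `S` vanishes on the
  field `F(S)` generated by them.

All statements are theorems (no new definitions).

## References

* S. Lang, *Algebra*, 3rd ed., Springer GTM 211 (2002), Ch. VIII §5.
* J. Ax, *On Schanuel's conjectures*, Ann. of Math. 93 (1971), 252–268, §2.
-/

noncomputable section

namespace Literature.NumberTheory.Transcendental

/-! ### Extension of derivations to the field of fractions -/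

section FractionField

variable {R A K : Type*} [CommRing R] [CommRing A] [IsDomain A] [Field K] [Algebra R A]
  [Algebra A K] [Algebra R K] [IsScalarTower R A K] [IsFractionRing A K]

/-- **Derivations extend to the fraction field.** If `K` is the field of fractions of `A` and
`D : A → K` is an `R`-derivation, there is an `R`-derivation `D' : K → K` with `D' a = D a` for
`a ∈ A` (namely `D'(a/b) = (b·Da - a·Db)/b²`). Proof: `Ω[K⁄R]` is the localisation of `Ω[A⁄R]`
(`K` is formally étale over `A`), so the `A`-linear map `Ω[A⁄R] → K` corresponding to `D`
extends to a `K`-linear map `Ω[K⁄R] → K`. [folklore] -/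
theorem exists_derivation_extend_of_isFractionRing (D : Derivation R A K) :
    ∃ D' : Derivation R K K, ∀ a : A, D' (algebraMap A K a) = D a := by
  have h : ∀ x : nonZeroDivisors A, IsUnit (algebraMap A (Module.End A K) x) := by
    intro x
    have hx : algebraMap A K x ≠ 0 :=
      IsFractionRing.to_map_ne_zero_of_mem_nonZeroDivisors x.2
    rw [Module.End.isUnit_iff]
    constructor
    · intro k k' hk
      simp only [Module.algebraMap_end_apply, Algebra.smul_def] at hk
      exact mul_left_cancel₀ hx hk
    · intro k
      exact ⟨(algebraMap A K x)⁻¹ * k, by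
        simp [Module.algebraMap_end_apply, Algebra.smul_def, hx]⟩
  let ℓ : Ω[K⁄R] →ₗ[A] K :=
    IsLocalizedModule.lift (nonZeroDivisors A) (KaehlerDifferential.map R R A K)
      D.liftKaehlerDifferential h
  let ℓ' : Ω[K⁄R] →ₗ[K] K := ℓ.extendScalarsOfIsLocalization (nonZeroDivisors A) K
  refine ⟨ℓ'.compDer (KaehlerDifferential.D R K), fun a => ?_⟩
  change ℓ' (KaehlerDifferential.D R K (algebraMap A K a)) = D a
  rw [LinearMap.extendScalarsOfIsLocalization_apply', ← KaehlerDifferential.map_D R R A K a,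
    IsLocalizedModule.lift_apply, Derivation.liftKaehlerDifferential_comp_D]

omit [Algebra R K] [IsScalarTower R A K] in
/-- **Uniqueness of the extension.** Two derivations of the fraction field `K` of `A` (with values
in a `K`-vector space) which agree on `A` are equal: if `δ` vanishes on `A` and `x = a/s` then
`0 = δ(s·x) = s·δx`. [folklore] -/
theorem derivation_eq_of_isFractionRing {S M : Type*} [CommRing S] [Algebra S K]
    [AddCommGroup M] [Module K M] [Module S M] [IsScalarTower S K M]
    (D₁ D₂ : Derivation S K M) (h : ∀ a : A, D₁ (algebraMap A K a) = D₂ (algebraMap A K a)) :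
    D₁ = D₂ := by
  rw [← sub_eq_zero]
  set δ := D₁ - D₂ with hδ
  have hA : ∀ a : A, δ (algebraMap A K a) = 0 := fun a => by
    rw [hδ, Derivation.sub_apply, h a, sub_self]
  ext x
  obtain ⟨a, s, rfl⟩ := IsLocalization.exists_mk'_eq (nonZeroDivisors A) x
  have hs : algebraMap A K s ≠ 0 :=
    IsFractionRing.to_map_ne_zero_of_mem_nonZeroDivisors s.2
  have hmul : algebraMap A K s * IsLocalization.mk' K a s = algebraMap A K a :=
    IsLocalization.mk'_spec' K a s
  have h1 : δ (algebraMap A K s * IsLocalization.mk' K a s) = 0 := by rw [hmul, hA]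
  rw [Derivation.leibniz, hA s, smul_zero, add_zero] at h1
  rw [Derivation.zero_apply]
  exact (smul_eq_zero.mp h1).resolve_left hs

end FractionField

/-! ### Derivations vanish at algebraic elements (characteristic zero) -/

section Algebraic

variable {F L : Type*} [Field F] [Field L] [Algebra F L]

/-- A derivation of `L` (over any base) which vanishes on (the image of) a subfield `F` is
`F`-linear; we record the consequence `D (c • a) = c • D a`. [folklore] -/
theorem derivation_map_smul_of_forall_algebraMap {S : Type*} [CommRing S] [Algebra S L]
    (D : Derivation S L L) (hF : ∀ c : F, D (algebraMap F L c) = 0) (c : F) (a : L) :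
    D (c • a) = c • D a := by
  rw [Algebra.smul_def, Derivation.leibniz, hF c, smul_zero, add_zero, smul_eq_mul,
    Algebra.smul_def]

/-- **Derivations kill algebraic elements in characteristic `0`.** If `D` is a derivation of the
field `L` vanishing on the subfield `F` (`char F = 0`) and `a ∈ L` is algebraic over `F`, then
`D a = 0`: with `p` the minimal polynomial of `a`, `0 = D(p(a)) = p'(a) · D a` and `p'(a) ≠ 0`
since `p` is separable. [folklore] -/
theorem derivation_eq_zero_of_isAlgebraic [CharZero F] {S : Type*} [CommRing S] [Algebra S L]
    (D : Derivation S L L) (hF : ∀ c : F, D (algebraMap F L c) = 0) {a : L}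
    (ha : IsAlgebraic F a) : D a = 0 := by
  -- the derivation as an `F`-derivation
  let D' : Derivation F L L :=
    { toFun := D
      map_add' := map_add D
      map_smul' := fun c x => derivation_map_smul_of_forall_algebraMap D hF c x
      map_one_eq_zero' := D.map_one_eq_zero
      leibniz' := fun x y => D.leibniz x y }
  have hD' : ∀ x, D' x = D x := fun _ => rfl
  have hint : IsIntegral F a := ha.isIntegral
  set p := minpoly F a with hp
  have hsep : p.Separable := (minpoly.irreducible hint).separable
  have hder : Polynomial.aeval a (Polynomial.derivative p) ≠ 0 :=
    hsep.aeval_derivative_ne_zero (minpoly.aeval F a)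
  have h := D'.map_aeval p a
  rw [minpoly.aeval, map_zero] at h
  have h' : Polynomial.aeval a (Polynomial.derivative p) • D' a = 0 := h.symm
  rw [smul_eq_zero] at h'
  rw [← hD']
  exact h'.resolve_left hder

/-- If `L` is algebraic over `F` (`char F = 0`), a derivation of `L` vanishing on `F` is zero.
[folklore] -/
theorem derivation_eq_zero_of_algebra_isAlgebraic [CharZero F] [Algebra.IsAlgebraic F L]
    {S : Type*} [CommRing S] [Algebra S L] (D : Derivation S L L)
    (hF : ∀ c : F, D (algebraMap F L c) = 0) : D = 0 := by
  ext a
  rw [Derivation.zero_apply]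
  exact derivation_eq_zero_of_isAlgebraic D hF (Algebra.IsAlgebraic.isAlgebraic a)

end Algebraic

/-! ### Derivations are determined on field generators -/

section Generators

variable {F E : Type*} [Field F] [Field E] [Algebra F E]

/-- A derivation of `E` vanishing on `F` and on `S ⊆ E` vanishes on the subfield `F(S)` generated
by `S` over `F` (closure under the field operations, `D(x⁻¹) = -x⁻² D x`). [folklore] -/
theorem derivation_eq_zero_on_adjoin {R M : Type*} [CommRing R] [Algebra R E] [AddCommGroup M]
    [Module E M] [Module R M] [IsScalarTower R E M]
    (D : Derivation R E M) (hF : ∀ c : F, D (algebraMap F E c) = 0)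
    {S : Set E} (hS : ∀ s ∈ S, D s = 0) {x : E} (hx : x ∈ IntermediateField.adjoin F S) :
    D x = 0 := by
  induction hx using IntermediateField.adjoin_induction with
  | mem x hx => exact hS x hx
  | algebraMap c => exact hF c
  | add x y _ _ hx hy => rw [map_add, hx, hy, add_zero]
  | inv x _ hx => rw [Derivation.leibniz_inv, hx, smul_zero]
  | mul x y _ _ hx hy => rw [Derivation.leibniz, hx, hy, smul_zero, smul_zero, add_zero]

/-- Two derivations of `E` which agree on `F` and on `S` agree on `F(S)`. [folklore] -/
theorem derivation_eqOn_adjoin {R M : Type*} [CommRing R] [Algebra R E] [AddCommGroup M]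
    [Module E M] [Module R M] [IsScalarTower R E M]
    (D₁ D₂ : Derivation R E M) (hF : ∀ c : F, D₁ (algebraMap F E c) = D₂ (algebraMap F E c))
    {S : Set E} (hS : ∀ s ∈ S, D₁ s = D₂ s) {x : E} (hx : x ∈ IntermediateField.adjoin F S) :
    D₁ x = D₂ x := by
  rw [← sub_eq_zero, ← Derivation.sub_apply]
  exact derivation_eq_zero_on_adjoin (D₁ - D₂)
    (fun c => by rw [Derivation.sub_apply, hF c, sub_self])
    (fun s hs => by rw [Derivation.sub_apply, hS s hs, sub_self]) hx

/-- If `E = F(S)`, a derivation of `E` vanishing on `F` and on `S` is zero. [folklore] -/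
theorem derivation_eq_zero_of_adjoin_eq_top {R M : Type*} [CommRing R] [Algebra R E]
    [AddCommGroup M] [Module E M] [Module R M] [IsScalarTower R E M]
    (D : Derivation R E M) (hF : ∀ c : F, D (algebraMap F E c) = 0)
    {S : Set E} (hS : ∀ s ∈ S, D s = 0) (htop : IntermediateField.adjoin F S = ⊤) : D = 0 := by
  ext x
  rw [Derivation.zero_apply]
  exact derivation_eq_zero_on_adjoin D hF hS
    (show x ∈ IntermediateField.adjoin F S from htop ▸ IntermediateField.mem_top)

/-- For an intermediate field `K' = F(S)` of `E/F`, the field `K'` is generated over `F` by the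
elements of `S` viewed inside `K'`: `F(S ∩ K') = ⊤` in `K'`. [folklore] -/
theorem IntermediateField.adjoin_preimage_val_eq_top (S : Set E) :
    IntermediateField.adjoin F
        (((↑) : IntermediateField.adjoin F S → E) ⁻¹' S) = ⊤ := by
  apply IntermediateField.lift_injective
  rw [IntermediateField.lift_adjoin, IntermediateField.lift_top,
    Set.image_preimage_eq_inter_range]
  have hr : Set.range ((↑) : IntermediateField.adjoin F S → E) =
      (IntermediateField.adjoin F S : Set E) := Subtype.range_coe
  rw [hr, Set.inter_eq_left.mpr (IntermediateField.subset_adjoin F S)]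

end Generators

end Literature.NumberTheory.Transcendental
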